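import Mathlib.FieldTheory.Finite.Basic
import Mathlib.FieldTheory.Separable
import Mathlib.Algebra.Squarefree.Basic
import Mathlib.Algebra.Polynomial.Expand
import Mathlib.Algebra.Polynomial.Roots
import Mathlib.Algebra.Ring.GeomSum
import Mathlib.RingTheory.RootsOfUnity.PrimitiveRoots
import HarnessLib

/-!
# AKS primality: introspective numbers (Agrawal–Kayal–Saxena 2004, §4)

The algebraic heart of the correctness proof of the Agrawal–Kayal–Saxena deterministic
polynomial-time primality test [AKS04, §4], in Mathlib terms:

* `AKS.Introspective r m f` — Definition 4.4 of [AKS04]: the number `m` is *introspective* for the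
  polynomial `f` (modulo `X ^ r - 1` and the characteristic of the coefficient ring `R`, which for
  [AKS04] is `𝔽_p`): `X ^ r - 1 ∣ f ^ m - f (X ^ m)`, with `f (X ^ m) = Polynomial.expand R m f`;
* Lemma 4.5 (`Introspective.mul_right`: introspective numbers for `f` are closed under
  multiplication) and Lemma 4.6 (`Introspective.mul`: the polynomials for which `m` is
  introspective are closed under multiplication), with the consequences for `1`, `X`, products
  and powers;
* over `𝔽_p = ZMod p`: `p` is introspective for every `f` (equation (4) of [AKS04], Frobenius),
  and the passage from `p * q` to `q` (equation (5): "`n / p` is introspective"), which the paper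
  leaves implicit and which holds because `X ^ r - 1` is squarefree when `p ∤ r`
  (`Introspective.of_mul_prime`); the transfer of the tested congruence
  `(X + a) ^ n = X ^ n + a (mod X ^ r - 1, n)` from `ZMod n` to `ZMod p` for `p ∣ n`
  (`introspective_of_congruence`);
* in a field `F ⊇ 𝔽_p` with a primitive `r`-th root of unity `ζ` (the paper's
  `F = 𝔽_p[X]/(h(X))`, `h ∣ Φ_r` irreducible; here any field extension with a chosen `ζ`):
  `(aeval ζ f) ^ m = aeval (ζ ^ m) f` for introspective `m` (`Introspective.aeval_pow`), the
  injectivity argument of Lemma 4.7 (`eq_of_aeval_eq`: two polynomials of degree `< #Z` that are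
  introspective along a set `Z` of powers of `ζ` and agree at `ζ` are equal), and the root count
  of Lemma 4.8 (`card_le_of_pow_eq_pow`: distinct elements `y` with `y ^ m₁ = y ^ m₂`, `m₂ < m₁`,
  are at most `m₁` in number).

The counting (Lemmas 4.7–4.9 proper) and the theorem "the congruences force `n` to be a prime
power" are in `AKSTheorem.lean`; the existence of a small `r` (Lemma 4.3) and the algorithm
(Theorem 4.1) follow in further files of this directory.

## References

* [AKS04] M. Agrawal, N. Kayal, N. Saxena, *PRIMES is in P*, Ann. of Math. 160 (2004) 781–793,
  §4: Def. 4.4, Lemmas 4.5, 4.6, 4.7, 4.8 (held: `doi:10.4007/annals.2004.160.781`, pp. 786–788).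
* A. Granville, *It is easy to determine whether a given integer is prime*, Bull. AMS 42 (2005)
  3–38 (the reducedness remark behind equation (5)).
-/

namespace Literature.NumberTheory.Primality

open Polynomial Finset

namespace AKS

/-! ### Definition 4.4 and Lemmas 4.5, 4.6 over a commutative ring -/

section CommRing

variable {R : Type*} [CommRing R]

/-- **Introspective numbers** [AKS04, Def. 4.4]: `m` is introspective for `f ∈ R[X]` modulo
`X ^ r - 1` when `f(X) ^ m ≡ f(X ^ m) (mod X ^ r - 1)`, i.e. `X ^ r - 1 ∣ f ^ m - expand R m f`.
In [AKS04] `R = 𝔽_p`; the definition and Lemmas 4.5–4.6 make sense over any commutative ring.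
[cite: AgrawalKayalSaxena2004, Def. 4.4] -/
def Introspective (r m : ℕ) (f : R[X]) : Prop :=
  (X ^ r - 1 : R[X]) ∣ f ^ m - expand R m f

/-- `1` is introspective for every polynomial (`f ^ 1 = f (X ^ 1)`). [folklore] -/
theorem introspective_one_left (r : ℕ) (f : R[X]) : Introspective r 1 f := by
  simp [Introspective, expand_one]

/-- Every `m` is introspective for the constant polynomial `1`. [folklore] -/
theorem introspective_one (r m : ℕ) : Introspective r m (1 : R[X]) := by
  simp [Introspective]

/-- Every `m` is introspective for `X` (`X ^ m = X ^ m`). [cite: AgrawalKayalSaxena2004, §4 (the set P contains X)] -/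
theorem introspective_X (r m : ℕ) : Introspective r m (X : R[X]) := by
  simp [Introspective, expand_X]

/-- **Lemma 4.5** [AKS04]: if `m` and `m'` are introspective for `f` then so is `m * m'`
(`f ^ (m m') = (f ^ m) ^ m' ≡ f(X ^ m) ^ m' ≡ f(X ^ (m m'))`, the second step being the
introspection equation for `m'` with `X` replaced by `X ^ m`, valid modulo `X ^ (m r) - 1`, a
multiple of `X ^ r - 1`). [cite: AgrawalKayalSaxena2004, Lemma 4.5] -/
theorem Introspective.mul_right {r m m' : ℕ} {f : R[X]} (hm : Introspective r m f)
    (hm' : Introspective r m' f) : Introspective r (m * m') f := by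
  unfold Introspective at *
  have h1 : (X ^ r - 1 : R[X]) ∣ (f ^ m) ^ m' - (expand R m f) ^ m' :=
    hm.trans (sub_dvd_pow_sub_pow _ _ _)
  have h2 : (X ^ r - 1 : R[X]) ∣ (expand R m f) ^ m' - expand R m (expand R m' f) := by
    have h := map_dvd (expand R m) hm'
    rw [map_sub, map_sub, map_pow, map_pow, map_one, expand_X] at h
    refine dvd_trans ?_ h
    rw [← pow_mul, mul_comm, pow_mul]
    simpa using sub_dvd_pow_sub_pow (X ^ r : R[X]) 1 m
  have h3 := dvd_add h1 h2
  rw [pow_mul, expand_mul]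
  convert h3 using 1
  ring

/-- **Lemma 4.6** [AKS04]: if `m` is introspective for `f` and for `g` then it is introspective for
`f * g`. [cite: AgrawalKayalSaxena2004, Lemma 4.6] -/
theorem Introspective.mul {r m : ℕ} {f g : R[X]} (hf : Introspective r m f)
    (hg : Introspective r m g) : Introspective r m (f * g) := by
  unfold Introspective at *
  have h : (f * g) ^ m - expand R m (f * g) =
      f ^ m * (g ^ m - expand R m g) + (f ^ m - expand R m f) * expand R m g := by
    rw [map_mul]; ring
  rw [h]
  exact dvd_add (dvd_mul_of_dvd_right hg _) (dvd_mul_of_dvd_left hf _)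

/-- Products: if `m` is introspective for every `f i`, `i ∈ s`, then for `∏ i ∈ s, f i`
(Lemma 4.6 iterated). [cite: AgrawalKayalSaxena2004, Lemma 4.6] -/
theorem Introspective.prod {ι : Type*} {r m : ℕ} (s : Finset ι) {f : ι → R[X]}
    (h : ∀ i ∈ s, Introspective r m (f i)) : Introspective r m (∏ i ∈ s, f i) := by
  classical
  induction s using Finset.induction_on with
  | empty => simpa using introspective_one r m
  | insert a s ha ih =>
    rw [Finset.prod_insert ha]
    exact (h a (Finset.mem_insert_self a s)).mul (ih fun i hi => h i (Finset.mem_insert_of_mem hi))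

/-- Powers of an introspective number are introspective (Lemma 4.5 iterated).
[cite: AgrawalKayalSaxena2004, Lemma 4.5] -/
theorem Introspective.pow {r m : ℕ} {f : R[X]} (h : Introspective r m f) (k : ℕ) :
    Introspective r (m ^ k) f := by
  induction k with
  | zero => simpa using introspective_one_left r f
  | succ k ih => rw [pow_succ]; exact ih.mul_right h

/-- The set `I = {q ^ i * p ^ j}` of [AKS04, §4]: if `q` and `p` are introspective for `f` then so
is every `q ^ i * p ^ j`. [cite: AgrawalKayalSaxena2004, §4 (the set I)] -/
theorem Introspective.pow_mul_pow {r q p : ℕ} {f : R[X]} (hq : Introspective r q f)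
    (hp : Introspective r p f) (i j : ℕ) : Introspective r (q ^ i * p ^ j) f :=
  (hq.pow i).mul_right (hp.pow j)

/-- Introspectivity is preserved by ring homomorphisms of the coefficients. [folklore] -/
theorem Introspective.map {S : Type*} [CommRing S] (φ : R →+* S) {r m : ℕ} {f : R[X]}
    (h : Introspective r m f) : Introspective r m (f.map φ) := by
  unfold Introspective at *
  have := map_dvd (mapRingHom φ) h
  simpa [Polynomial.map_expand] using this

end CommRing

/-! ### Over `𝔽_p`: equations (3)–(5) of [AKS04] -/

section ZModP

variable {p : ℕ} [hp : Fact p.Prime]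

/-- **Equation (4)** [AKS04]: a prime `p` is introspective for every `f ∈ 𝔽_p[X]`, indeed
`f(X) ^ p = f(X ^ p)` exactly (Frobenius; Mathlib's `ZMod.expand_card`).
[cite: AgrawalKayalSaxena2004, §4 eq. (4) and Lemma 2.1] -/
theorem introspective_prime (r : ℕ) (f : (ZMod p)[X]) : Introspective r p f := by
  simp [Introspective, ZMod.expand_card]

/-- `X ^ r - 1` is squarefree over `𝔽_p` when `p ∤ r` (it is separable). [folklore] -/
theorem squarefree_X_pow_sub_one {r : ℕ} (hr : ¬p ∣ r) : Squarefree (X ^ r - 1 : (ZMod p)[X]) := by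
  have h := Polynomial.separable_X_pow_sub_C' p r (1 : ZMod p) hr one_ne_zero
  rw [map_one] at h
  exact h.squarefree

/-- **Equation (5)** [AKS04] ("`n / p` is introspective"): over `𝔽_p` with `p ∤ r`, if `p * q` is
introspective for `f` then so is `q`. Indeed `(f ^ q) ^ p ≡ f(X ^ (p q)) = f(X ^ q) ^ p`, i.e.
`X ^ r - 1` divides `(f ^ q - f(X ^ q)) ^ p`, and `X ^ r - 1` is squarefree, hence radical. (This
step is implicit in [AKS04, p. 786]; cf. Granville 2005.) [cite: AgrawalKayalSaxena2004, §4 eq. (5)] -/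
theorem Introspective.of_mul_prime {r q : ℕ} (hr : ¬p ∣ r) {f : (ZMod p)[X]}
    (h : Introspective r (p * q) f) : Introspective r q f := by
  unfold Introspective at *
  have key : f ^ (p * q) - expand (ZMod p) (p * q) f = (f ^ q - expand (ZMod p) q f) ^ p := by
    rw [sub_pow_char, ← pow_mul, mul_comm q p, expand_mul, ZMod.expand_card, ← map_pow]
  rw [key] at h
  exact (squarefree_X_pow_sub_one hr).isRadical p _ h

/-- **Equation (3) ⇒ introspectivity** [AKS04, p. 786]: if `p ∣ n` and the tested congruence
`(X + a) ^ n ≡ X ^ n + a (mod X ^ r - 1, n)` holds in `(ZMod n)[X]`, then `n` is introspective for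
`X + a` over `𝔽_p`. [cite: AgrawalKayalSaxena2004, §4 eq. (3)] -/
theorem introspective_of_congruence {n r a : ℕ} (hpn : p ∣ n)
    (h : (X ^ r - 1 : (ZMod n)[X]) ∣ (X + C (a : ZMod n)) ^ n - (X ^ n + C (a : ZMod n))) :
    Introspective r n (X + C (a : ZMod p)) := by
  unfold Introspective
  have := map_dvd (mapRingHom (ZMod.castHom hpn (ZMod p))) h
  simpa [expand_X, expand_C] using this

/-- Hence, for `n = p * q` with `p ∤ r`, every `q ^ i * p ^ j` is introspective for `X + a` over
`𝔽_p` once the congruence for `a` holds modulo `n` ("every number in `I` is introspective for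
every polynomial in `P`", [AKS04, p. 787]). [cite: AgrawalKayalSaxena2004, §4 (sets I and P)] -/
theorem introspective_pow_mul_pow_of_congruence {q r a : ℕ} (hr : ¬p ∣ r)
    (h : (X ^ r - 1 : (ZMod (p * q))[X]) ∣
      (X + C (a : ZMod (p * q))) ^ (p * q) - (X ^ (p * q) + C (a : ZMod (p * q)))) (i j : ℕ) :
    Introspective r (q ^ i * p ^ j) (X + C (a : ZMod p)) :=
  ((introspective_of_congruence (dvd_mul_right p q) h).of_mul_prime hr).pow_mul_pow
    (introspective_prime r _) i j

end ZModP

/-! ### In a field with a primitive `r`-th root of unity: the engine of Lemmas 4.7 and 4.8 -/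

section Field

variable {K F : Type*} [Field K] [Field F] [Algebra K F]

/-- A multiple of `X ^ r - 1` vanishes at an `r`-th root of unity. [folklore] -/
theorem aeval_eq_zero_of_dvd {ζ : F} {r : ℕ} (hζ : ζ ^ r = 1) {g : K[X]}
    (h : (X ^ r - 1 : K[X]) ∣ g) : aeval ζ g = 0 := by
  obtain ⟨u, rfl⟩ := h
  simp [hζ]

/-- **Introspection seen in `F`**: if `m` is introspective for `f` modulo `X ^ r - 1` and
`ζ ^ r = 1`, then `f(ζ) ^ m = f(ζ ^ m)` in `F` ([AKS04], proofs of Lemmas 4.7 and 4.8: "since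
`h(X)` divides `X ^ r - 1`"). [cite: AgrawalKayalSaxena2004, Lemma 4.7 (proof)] -/
theorem Introspective.aeval_pow {ζ : F} {r m : ℕ} (hζ : ζ ^ r = 1) {f : K[X]}
    (h : Introspective r m f) : (aeval ζ f) ^ m = aeval (ζ ^ m) f := by
  have h0 := aeval_eq_zero_of_dvd hζ h
  rw [map_sub, map_pow, expand_aeval, sub_eq_zero] at h0
  exact h0

/-- **The injectivity argument of Lemma 4.7** [AKS04] (H. Lenstra Jr.): let `Z ⊆ F` consist of
powers `ζ ^ m` (`ζ ^ r = 1`) of exponents `m` introspective for both `f` and `g`. If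
`f(ζ) = g(ζ)` then every `z ∈ Z` is a root of `Q(Y) = f(Y) - g(Y)`; so if `deg f, deg g < #Z`
then `f = g`. [cite: AgrawalKayalSaxena2004, Lemma 4.7] -/
theorem eq_of_aeval_eq {ζ : F} {r : ℕ} (hζ : ζ ^ r = 1) {f g : K[X]} (Z : Finset F)
    (hZ : ∀ z ∈ Z, ∃ m : ℕ, z = ζ ^ m ∧ Introspective r m f ∧ Introspective r m g)
    (hf : f.natDegree < #Z) (hg : g.natDegree < #Z) (heq : aeval ζ f = aeval ζ g) : f = g := by
  have hQ : (f - g).map (algebraMap K F) = 0 := by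
    refine eq_zero_of_natDegree_lt_card_of_eval_eq_zero' _ Z (fun z hz => ?_) ?_
    · obtain ⟨m, rfl, hmf, hmg⟩ := hZ z hz
      rw [eval_map_algebraMap, map_sub, ← hmf.aeval_pow hζ, ← hmg.aeval_pow hζ, heq, sub_self]
    · refine lt_of_le_of_lt (natDegree_map_le) ?_
      exact lt_of_le_of_lt (natDegree_sub_le _ _) (max_lt hf hg)
  rw [Polynomial.map_eq_zero_iff (algebraMap K F).injective] at hQ
  exact sub_eq_zero.mp hQ

/-- **The root count of Lemma 4.8** [AKS04] (in the formulation of Kalai–Sahai–Sudan): a finite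
set of elements `y ∈ F` all satisfying `y ^ m₁ = y ^ m₂` with `m₂ < m₁` has at most `m₁` elements,
being a set of roots of the nonzero polynomial `Y ^ m₁ - Y ^ m₂`.
[cite: AgrawalKayalSaxena2004, Lemma 4.8] -/
theorem card_le_of_pow_eq_pow {m₁ m₂ : ℕ} (hm : m₂ < m₁) (S : Finset F)
    (hS : ∀ y ∈ S, y ^ m₁ = y ^ m₂) : #S ≤ m₁ := by
  have hdeg : (X ^ m₁ - X ^ m₂ : F[X]).natDegree = m₁ := by
    rw [natDegree_sub_eq_left_of_natDegree_lt] <;> simp [hm]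
  by_contra hlt
  have h0 : (X ^ m₁ - X ^ m₂ : F[X]) = 0 :=
    eq_zero_of_natDegree_lt_card_of_eval_eq_zero' _ S (fun y hy => by simp [hS y hy])
      (by rw [hdeg]; omega)
  have := congrArg natDegree h0
  rw [hdeg, natDegree_zero] at this
  omega

/-- Powers of a primitive `r`-th root of unity only depend on the exponent modulo `r`. [folklore] -/
theorem pow_eq_pow_of_modEq {ζ : F} {r : ℕ} (hζ : ζ ^ r = 1) {a b : ℕ} (h : a ≡ b [MOD r]) :
    ζ ^ a = ζ ^ b := by
  rw [← Nat.div_add_mod a r, ← Nat.div_add_mod b r, pow_add, pow_add, pow_mul, pow_mul, hζ,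
    one_pow, one_pow, one_mul, one_mul, h]

/-- Distinct residues give distinct powers of a primitive root: `m ↦ ζ ^ m.val` is injective on
`ZMod r`. [folklore] -/
theorem pow_val_injective {ζ : F} {r : ℕ} [NeZero r] (hζ : IsPrimitiveRoot ζ r) :
    Function.Injective fun x : ZMod r => ζ ^ x.val := by
  intro x y hxy
  have := hζ.pow_inj (ZMod.val_lt x) (ZMod.val_lt y) hxy
  exact ZMod.val_injective r this

end Field

end AKS

end Literature.NumberTheory.Primality
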